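import Mathlib
import HarnessLib
import Summits.Langlands.Langlands.Theses.SkinnerWilesDefectOne

/-!
# `EisensteinProModularSeed` (stmt-Langlands-12920) — Negative knowledge I: reading the ORIENTATION
# clause residually (both directions) and the inertial type it forces

From the standing disprover's `Cruxes/EisensteinProModularSeed/Disproof.lean` (cdisprove gen 2,
cycle 1, §6.3), unconditional lemmas on the crux's local clause
`∃ Q, ‖Q₀₀‖ ≤ ‖Q₁₀‖ ∧ ∀ σ, (Q⁻¹ r|_{F_v}(σ) Q)₁₀ = 0 ∧ (σ ∈ I_v → θ₂^m = 1 ∧ θ₁^m = ε^{(k-1)m})`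
(for `ρ` in the hypotheses and for the partner `r` in the conclusion alike), with `O = 𝒪_{ℚ̄_p}` and a
residually upper-triangular integral model `r₀` in the frame `(e₀, e₁)`:

* `orientedFrame_diag_congr` (+ `_toLocal`) — ORIENTED ⇒ `θ₁ ≡ (r₀)₁₁` (the ordinary sub-character
  reduces to the residual QUOTIENT character) and `θ₂ ≡ (r₀)₀₀` (the unit-root character reduces to the
  residual SUB), integrally, at every element: Skinner–Wiles' type-𝒟 orientation, demanded at EVERY
  `v ∣ p` (Publ. IHÉS 89 (1999), Thm A);
* `oriented_of_unitRoot_congr` (+ `_toLocal`) — the CONVERSE: a frame upper-triangular at ONE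
  residually distinguished element whose unit-root entry is `≡ (r₀)₀₀` is oriented; so for
  `p`-distinguished data the typed clause ⟺ "ordinary in some frame with unit-root character `≡ χ̄_a`";
* `inertial_type_of_orientedOrdinary` — `(k, m)` force `χ̄_a|_{I_v}` of order `∣ m` (UNRAMIFIED for
  `m = 1`) and `χ̄_b|_{I_v} = ω^{k-1}·`(order `∣ m`): the residual inertial type at every `v ∣ p`.

Imports the route file only for the vocabulary cone; no statement of the route is used or asserted.
[folklore]
-/

set_option linter.dupNamespace false -- project-wide option (lakefile weak.linter.dupNamespace); `Summit.Langlands.Langlands` is the mandated namespace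

namespace Summit.Langlands.Langlands.Theorems.EisensteinProModularSeed.Negative

open Literature.NumberTheory.GaloisRepresentations
open Literature.NumberTheory.Automorphic
open Literature.NumberTheory.Automorphic.BigHeckeGLn
open IsDedekindDomain IsLocalRing Field Polynomial
open scoped NumberField Matrix

section

variable {A : Type*} [Field A]

/-- The first column of an invertible `2 × 2` matrix over a field is non-zero. [folklore] -/
theorem col_zero_ne_zero (P : GL (Fin 2) A) : (fun i => (P : Matrix (Fin 2) (Fin 2) A) i 0) ≠ 0 := by
  intro h
  have h0 : (P : Matrix (Fin 2) (Fin 2) A) 0 0 = 0 := congrFun h 0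
  have h1 : (P : Matrix (Fin 2) (Fin 2) A) 1 0 = 0 := congrFun h 1
  have hdet : (P : Matrix (Fin 2) (Fin 2) A).det = 0 := by
    rw [Matrix.det_fin_two, h0, h1]; ring
  exact (Matrix.GeneralLinearGroup.det P).ne_zero
    (by rw [Matrix.GeneralLinearGroup.val_det_apply]; exact hdet)

end

/-! ### Reading an oriented frame residually -/

section Orientation

variable {p : ℕ} [Fact p.Prime] {O : ValuationSubring (PadicAlgCl p)}
variable {G : Type*} [Group G] [TopologicalSpace G]

/-- Entries of a framed representation with an integral model in the same frame are the images of the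
model's entries. [folklore] -/
theorem entry_eq_of_integralModel {n : ℕ} {r : FramedRep G (PadicAlgCl p) n} {r₀ : G →* GL (Fin n) O}
    (h : FramedRep.HasUpperTriangularIntegralModel r r₀) (g : G) (i j : Fin n) :
    (r g).val i j = ((r₀ g).val i j : PadicAlgCl p) := by
  rw [← h.1 g]; rfl

/-- The orientation inequality `‖Q₀₀‖ ≤ ‖Q₁₀‖` forces `Q₁₀ ≠ 0`: the line `ℚ̄_p · Q e₀` is never the
coordinate line `e₀` (genuine transversality). [folklore] -/
theorem orientation_ne_zero (Q : Matrix.GeneralLinearGroup (Fin 2) (PadicAlgCl p))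
    (hQ : Valued.v (Q.val 0 0) ≤ Valued.v (Q.val 1 0)) : Q.val 1 0 ≠ 0 := by
  intro h10
  have h00 : Q.val 0 0 = 0 := by
    rw [h10, map_zero, nonpos_iff_eq_zero, map_eq_zero] at hQ
    exact hQ
  exact col_zero_ne_zero Q (funext fun i => by fin_cases i <;> assumption)

/-- **What the orientation inequality says residually.** Let `r₀` be a residually upper-triangular
integral model of `r` over `O = 𝒪_{ℚ̄_p}` in the frame `(e₀, e₁)` (`(r₀)₀₀ mod 𝔪` the character of the
residual sub-line `⟨ē₀⟩`, `(r₀)₁₁ mod 𝔪` that of the quotient) and `Q` an ORIENTED frame at `σ`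
(`‖Q₀₀‖ ≤ ‖Q₁₀‖`, `(Q⁻¹ r(σ) Q)₁₀ = 0`). Then `θ₁(σ) = (Q⁻¹ r(σ) Q)₀₀` (the character of the stable line
`Q e₀`) and `θ₂(σ) = (Q⁻¹ r(σ) Q)₁₁` are INTEGRAL with `θ₁(σ) ≡ (r₀ σ)₁₁` and `θ₂(σ) ≡ (r₀ σ)₀₀ (mod 𝔪)`:
in the crux (where `θ₁^m = ε^{(k-1)m}` on inertia) the ordinary sub-character reduces to the residual
QUOTIENT and the unit-root character to the residual SUB — Skinner–Wiles' type-𝒟 orientation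
(Publ. IHÉS 89 (1999), Thm A). Proof: `Q e₀ ∼ (u, 1)` with `u = Q₀₀/Q₁₀ ∈ O` (this uses
`O = 𝒪_{ℚ̄_p}`), `r₀(σ)(u, 1)ᵀ = (∗, c u + d)ᵀ` with `c ∈ 𝔪`, and the trace. [folklore] -/
theorem orientedFrame_diag_congr (hO : O = (Valued.v : Valuation (PadicAlgCl p) NNReal).valuationSubring)
    {r : FramedRep G (PadicAlgCl p) 2} {r₀ : G →* GL (Fin 2) O}
    (hmod : FramedRep.HasUpperTriangularIntegralModel r r₀)
    (Q : Matrix.GeneralLinearGroup (Fin 2) (PadicAlgCl p))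
    (hQ : Valued.v (Q.val 0 0) ≤ Valued.v (Q.val 1 0)) (σ : G) (hB : (Q⁻¹ * r σ * Q).val 1 0 = 0) :
    ∃ t₁ t₂ : O, (t₁ : PadicAlgCl p) = (Q⁻¹ * r σ * Q).val 0 0 ∧
      (t₂ : PadicAlgCl p) = (Q⁻¹ * r σ * Q).val 1 1 ∧
      t₁ - (r₀ σ).val 1 1 ∈ maximalIdeal O ∧ t₂ - (r₀ σ).val 0 0 ∈ maximalIdeal O := by
  have hQ10 : Q.val 1 0 ≠ 0 := orientation_ne_zero Q hQ
  have hu : Q.val 0 0 / Q.val 1 0 ∈ O := by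
    rw [hO, Valuation.mem_valuationSubring_iff, map_div₀]
    exact div_le_one_of_le₀ hQ zero_le
  set u : O := ⟨Q.val 0 0 / Q.val 1 0, hu⟩ with hu_def
  have hu' : Q.val 0 0 / Q.val 1 0 * Q.val 1 0 = Q.val 0 0 := div_mul_cancel₀ _ hQ10
  have hc : (r₀ σ).val 1 0 ∈ maximalIdeal O :=
    ((isResiduallyUpperTriangular_two_iff r₀).mp hmod.2) σ
  set B := Q⁻¹ * r σ * Q with hBdef
  have hB10 : (B : Matrix (Fin 2) (Fin 2) (PadicAlgCl p)) 1 0 = 0 := hB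
  have e : r σ * Q = Q * B := by rw [hBdef]; group
  have h10 := congrArg (fun M : GL (Fin 2) (PadicAlgCl p) => (M : Matrix (Fin 2) (Fin 2) (PadicAlgCl p)) 1 0) e
  simp only [Units.val_mul, Matrix.mul_apply, Fin.sum_univ_two] at h10
  rw [hB10, mul_zero, add_zero, entry_eq_of_integralModel hmod σ 1 0,
    entry_eq_of_integralModel hmod σ 1 1] at h10
  have hB00 : (B : Matrix (Fin 2) (Fin 2) (PadicAlgCl p)) 0 0 =
      ((r₀ σ).val 1 0 : PadicAlgCl p) * (Q.val 0 0 / Q.val 1 0) +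
        ((r₀ σ).val 1 1 : PadicAlgCl p) := by
    apply mul_right_cancel₀ hQ10
    linear_combination -h10 - ((r₀ σ).val 1 0 : PadicAlgCl p) * hu'
  have hBval : (B : Matrix (Fin 2) (Fin 2) (PadicAlgCl p)) =
      ((Q⁻¹ : GL (Fin 2) (PadicAlgCl p)) : Matrix (Fin 2) (Fin 2) (PadicAlgCl p)) * (r σ).val *
        (Q : Matrix (Fin 2) (Fin 2) (PadicAlgCl p)) := by
    rw [hBdef, Units.val_mul, Units.val_mul]
  have htr : (B : Matrix (Fin 2) (Fin 2) (PadicAlgCl p)) 0 0 +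
      (B : Matrix (Fin 2) (Fin 2) (PadicAlgCl p)) 1 1 =
      ((r₀ σ).val 0 0 : PadicAlgCl p) + ((r₀ σ).val 1 1 : PadicAlgCl p) := by
    have t := Matrix.trace_units_conj' Q (r σ).val
    rw [Matrix.trace_fin_two, Matrix.trace_fin_two, entry_eq_of_integralModel hmod σ 0 0,
      entry_eq_of_integralModel hmod σ 1 1] at t
    rw [hBval]
    exact t
  have hB11 : (B : Matrix (Fin 2) (Fin 2) (PadicAlgCl p)) 1 1 =
      ((r₀ σ).val 0 0 : PadicAlgCl p) -
        ((r₀ σ).val 1 0 : PadicAlgCl p) * (Q.val 0 0 / Q.val 1 0) := by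
    linear_combination htr - hB00
  refine ⟨(r₀ σ).val 1 0 * u + (r₀ σ).val 1 1, (r₀ σ).val 0 0 - (r₀ σ).val 1 0 * u, ?_, ?_, ?_, ?_⟩
  · rw [hB00]; push_cast; rw [hu_def]
  · rw [hB11]; push_cast; rw [hu_def]
  · rw [add_sub_cancel_right]; exact Ideal.mul_mem_right _ _ hc
  · rw [sub_sub_cancel_left]; exact (maximalIdeal O).neg_mem (Ideal.mul_mem_right _ _ hc)

/-- `orientedFrame_diag_congr` at a finite place: for `r : Γ_F → GL₂(ℚ̄_p)` and the frame of
`r.toLocal v` at `σ ∈ Γ_{F_v}`, the congruences hold against `r₀ (absGaloisRestrict F F_v σ)` (verbatim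
the shape of the crux's local clause `(Q⁻¹ * r.toLocal v σ * Q).val 1 0 = 0`). [folklore] -/
theorem orientedFrame_diag_congr_toLocal {F : Type} [Field F] [NumberField F]
    (hO : O = (Valued.v : Valuation (PadicAlgCl p) NNReal).valuationSubring)
    {r : FramedGaloisRep F (PadicAlgCl p) 2}
    {r₀ : absoluteGaloisGroup F →* Matrix.GeneralLinearGroup (Fin 2) O}
    (hmod : r.HasUpperTriangularIntegralModel r₀) (v : HeightOneSpectrum (𝓞 F))
    (Q : Matrix.GeneralLinearGroup (Fin 2) (PadicAlgCl p))
    (hQ : Valued.v (Q.val 0 0) ≤ Valued.v (Q.val 1 0))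
    (σ : absoluteGaloisGroup (v.adicCompletion F)) (hB : (Q⁻¹ * r.toLocal v σ * Q).val 1 0 = 0) :
    ∃ t₁ t₂ : O, (t₁ : PadicAlgCl p) = (Q⁻¹ * r.toLocal v σ * Q).val 0 0 ∧
      (t₂ : PadicAlgCl p) = (Q⁻¹ * r.toLocal v σ * Q).val 1 1 ∧
      t₁ - (r₀ (absGaloisRestrict F (v.adicCompletion F) σ)).val 1 1 ∈ maximalIdeal O ∧
      t₂ - (r₀ (absGaloisRestrict F (v.adicCompletion F) σ)).val 0 0 ∈ maximalIdeal O :=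
  orientedFrame_diag_congr hO hmod Q hQ (absGaloisRestrict F (v.adicCompletion F) σ) hB

/-- `a ≡ b (mod 𝔪)` iff equal residues. [folklore] -/
theorem sub_mem_maximalIdeal_iff {a b : O} : a - b ∈ maximalIdeal O ↔ residue O a = residue O b := by
  rw [← residue_eq_zero_iff, map_sub, sub_eq_zero]

/-- Congruence mod `𝔪` passes to powers. [folklore] -/
theorem pow_sub_pow_mem_maximalIdeal {a b : O} (h : a - b ∈ maximalIdeal O) (n : ℕ) :
    a ^ n - b ^ n ∈ maximalIdeal O := by
  rw [sub_mem_maximalIdeal_iff] at h ⊢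
  rw [map_pow, map_pow, h]

/-- **Inertial type of an oriented-ordinary datum** (the crux's local clause at `v`, verbatim, after
`obtain ⟨Q, hQ, hQσ⟩`). For every `σ` in the inertia group of `F_v`: `(r₀ σ)₀₀ ^ m ≡ 1 (mod 𝔪)` — the
residual SUB character has order dividing `m` on `I_v`, so is UNRAMIFIED at `v` when `m = 1` — and
`(r₀ σ)₁₁ ≡ t₁` with `t₁ ^ m = ε(σ)^{(k-1)m}` — the residual QUOTIENT character is `ω^{k-1}` times a
character of order dividing `m` on `I_v`.  A witness with `m = 1` therefore exists only for pairs of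
"parallel" residual inertial type at EVERY `v ∣ p`. [folklore] -/
theorem inertial_type_of_orientedOrdinary {F : Type} [Field F] [NumberField F]
    (hO : O = (Valued.v : Valuation (PadicAlgCl p) NNReal).valuationSubring)
    {r : FramedGaloisRep F (PadicAlgCl p) 2}
    {r₀ : absoluteGaloisGroup F →* Matrix.GeneralLinearGroup (Fin 2) O}
    (hmod : r.HasUpperTriangularIntegralModel r₀) {v : HeightOneSpectrum (𝓞 F)} {k m : ℕ}
    (Q : Matrix.GeneralLinearGroup (Fin 2) (PadicAlgCl p))
    (hQ : Valued.v (Q.val 0 0) ≤ Valued.v (Q.val 1 0))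
    (hQσ : ∀ σ, (Q⁻¹ * r.toLocal v σ * Q).val 1 0 = 0 ∧
      (σ ∈ absInertia (v.adicCompletion F) →
        (Q⁻¹ * r.toLocal v σ * Q).val 1 1 ^ m = 1 ∧
        (Q⁻¹ * r.toLocal v σ * Q).val 0 0 ^ m =
          algebraMap (Padic p) (PadicAlgCl p)
            (((GaloisRep.cyclotomicCharacter (v.adicCompletion F) p σ).val : PadicInt p) :
              Padic p) ^ ((k - 1) * m))) :
    ∀ σ ∈ absInertia (v.adicCompletion F),
      (r₀ (absGaloisRestrict F (v.adicCompletion F) σ)).val 0 0 ^ m - 1 ∈ maximalIdeal O ∧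
      ∃ t₁ : O, t₁ - (r₀ (absGaloisRestrict F (v.adicCompletion F) σ)).val 1 1 ∈ maximalIdeal O ∧
        (t₁ : PadicAlgCl p) ^ m =
          algebraMap (Padic p) (PadicAlgCl p)
            (((GaloisRep.cyclotomicCharacter (v.adicCompletion F) p σ).val : PadicInt p) :
              Padic p) ^ ((k - 1) * m) := by
  intro σ hσ
  obtain ⟨hB, hin⟩ := hQσ σ
  obtain ⟨h11, h00⟩ := hin hσ
  obtain ⟨t₁, t₂, ht₁, ht₂, ht₁', ht₂'⟩ := orientedFrame_diag_congr_toLocal hO hmod v Q hQ σ hB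
  refine ⟨?_, t₁, ht₁', by rw [ht₁]; exact h00⟩
  have ht₂m : t₂ ^ m = 1 := by
    apply Subtype.coe_injective
    push_cast
    rw [ht₂]
    exact h11
  have h' := pow_sub_pow_mem_maximalIdeal (sub_mem_comm_iff.mp ht₂') m
  rw [ht₂m] at h'
  exact h'

/-- In `O = 𝒪_{ℚ̄_p}`, an element of valuation `< 1` lies in the maximal ideal (a unit of `O` has
valuation `1`). [folklore] -/
theorem mem_maximalIdeal_of_v_lt_one
    (hO : O = (Valued.v : Valuation (PadicAlgCl p) NNReal).valuationSubring) {x : O}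
    (hx : Valued.v (x : PadicAlgCl p) < 1) : x ∈ maximalIdeal O := by
  subst hO
  rw [IsLocalRing.mem_maximalIdeal, mem_nonunits_iff]
  intro hu
  obtain ⟨y, hxy⟩ := hu.exists_right_inv
  have hy : Valued.v (y : PadicAlgCl p) ≤ 1 :=
    (Valuation.mem_valuationSubring_iff _ _).mp y.2
  have h1 : Valued.v (x : PadicAlgCl p) * Valued.v (y : PadicAlgCl p) = 1 := by
    rw [← map_mul, ← map_one (Valued.v : Valuation (PadicAlgCl p) NNReal)]
    congr 1
    exact_mod_cast congrArg Subtype.val hxy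
  have h2 : Valued.v (x : PadicAlgCl p) * Valued.v (y : PadicAlgCl p) < 1 :=
    mul_lt_one_of_nonneg_of_lt_one_left zero_le hx hy
  exact absurd h1 h2.ne

/-- **Converse orientation lemma** (the ideators' `oriented_of_unitRoot_congr`, stub P1 of cards
`big-image-cousin` / `ell-switch-geometric-seed`, listed there as cheapest falsifier (a) — PROVED, so
the cards read the crux correctly).  Let `r₀` be a residually upper-triangular integral model of `r`
(`O = 𝒪_{ℚ̄_p}`) and `Q` ANY frame with `(Q⁻¹ r(g) Q)₁₀ = 0` at ONE element `g` where the residual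
diagonal is distinguished (`(r₀ g)₀₀ ≢ (r₀ g)₁₁`); if the lower-right ("unit-root", quotient) entry
`(Q⁻¹ r(g) Q)₁₁` is `≡ (r₀ g)₀₀ (mod 𝔪)`, then `Q` is ORIENTED: `‖Q₀₀‖ ≤ ‖Q₁₀‖`.  With
`orientedFrame_diag_congr`: for `p`-distinguished data the typed orientation clause ⟺ "ordinary in some
frame whose unit-root character is `≡ χ̄_a` at one distinguished `σ ∈ Γ_{F_v}`" ⟺ "… at every `σ`".
Proof: an anti-oriented frame has its stable line reducing INTO `⟨ē₀⟩` (`u = Q₁₀/Q₀₀ ∈ 𝔪`), whence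
`θ₁ = a + b u ≡ a`, `θ₂ = d - b u ≡ d`, and `θ₂ ≡ a` forces `a ≡ d`. [folklore] -/
theorem oriented_of_unitRoot_congr
    (hO : O = (Valued.v : Valuation (PadicAlgCl p) NNReal).valuationSubring)
    {r : FramedRep G (PadicAlgCl p) 2} {r₀ : G →* GL (Fin 2) O}
    (hmod : FramedRep.HasUpperTriangularIntegralModel r r₀)
    (Q : Matrix.GeneralLinearGroup (Fin 2) (PadicAlgCl p)) (g : G)
    (hB : (Q⁻¹ * r g * Q).val 1 0 = 0)
    (hunit : ∃ t : O, (t : PadicAlgCl p) = (Q⁻¹ * r g * Q).val 1 1 ∧ t - (r₀ g).val 0 0 ∈ maximalIdeal O)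
    (hdist : (r₀ g).val 0 0 - (r₀ g).val 1 1 ∉ maximalIdeal O) :
    Valued.v (Q.val 0 0) ≤ Valued.v (Q.val 1 0) := by
  by_contra hlt
  push Not at hlt
  -- anti-oriented: `Q₀₀ ≠ 0`, `u = Q₁₀ / Q₀₀ ∈ 𝔪`
  have hQ00 : Q.val 0 0 ≠ 0 := by
    intro h0; rw [h0, map_zero] at hlt; exact (not_lt_of_ge zero_le) hlt
  have hvu : Valued.v (Q.val 1 0 / Q.val 0 0) < 1 := by
    rw [map_div₀]; exact (div_lt_one ((Valuation.pos_iff _).mpr hQ00)).mpr hlt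
  have hu : Q.val 1 0 / Q.val 0 0 ∈ O := by
    rw [hO, Valuation.mem_valuationSubring_iff]; exact hvu.le
  set u : O := ⟨Q.val 1 0 / Q.val 0 0, hu⟩ with hu_def
  have hum : u ∈ maximalIdeal O := mem_maximalIdeal_of_v_lt_one hO (by simpa [hu_def] using hvu)
  have hu' : Q.val 1 0 / Q.val 0 0 * Q.val 0 0 = Q.val 1 0 := div_mul_cancel₀ _ hQ00
  set B := Q⁻¹ * r g * Q with hBdef
  have hB10 : (B : Matrix (Fin 2) (Fin 2) (PadicAlgCl p)) 1 0 = 0 := hB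
  have e : r g * Q = Q * B := by rw [hBdef]; group
  -- row 0 of column 0: `a Q₀₀ + b Q₁₀ = Q₀₀ B₀₀`
  have h00 := congrArg (fun M : GL (Fin 2) (PadicAlgCl p) => (M : Matrix (Fin 2) (Fin 2) (PadicAlgCl p)) 0 0) e
  simp only [Units.val_mul, Matrix.mul_apply, Fin.sum_univ_two] at h00
  rw [hB10, mul_zero, add_zero, entry_eq_of_integralModel hmod g 0 0,
    entry_eq_of_integralModel hmod g 0 1] at h00
  have hB00 : (B : Matrix (Fin 2) (Fin 2) (PadicAlgCl p)) 0 0 =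
      ((r₀ g).val 0 0 : PadicAlgCl p) + ((r₀ g).val 0 1 : PadicAlgCl p) * (Q.val 1 0 / Q.val 0 0) := by
    apply mul_right_cancel₀ hQ00
    linear_combination -h00 - ((r₀ g).val 0 1 : PadicAlgCl p) * hu'
  -- trace: `B₁₁ = d - b u`
  have hBval : (B : Matrix (Fin 2) (Fin 2) (PadicAlgCl p)) =
      ((Q⁻¹ : GL (Fin 2) (PadicAlgCl p)) : Matrix (Fin 2) (Fin 2) (PadicAlgCl p)) * (r g).val *
        (Q : Matrix (Fin 2) (Fin 2) (PadicAlgCl p)) := by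
    rw [hBdef, Units.val_mul, Units.val_mul]
  have htr : (B : Matrix (Fin 2) (Fin 2) (PadicAlgCl p)) 0 0 +
      (B : Matrix (Fin 2) (Fin 2) (PadicAlgCl p)) 1 1 =
      ((r₀ g).val 0 0 : PadicAlgCl p) + ((r₀ g).val 1 1 : PadicAlgCl p) := by
    have t := Matrix.trace_units_conj' Q (r g).val
    rw [Matrix.trace_fin_two, Matrix.trace_fin_two, entry_eq_of_integralModel hmod g 0 0,
      entry_eq_of_integralModel hmod g 1 1] at t
    rw [hBval]
    exact t
  have hB11 : (B : Matrix (Fin 2) (Fin 2) (PadicAlgCl p)) 1 1 =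
      ((r₀ g).val 1 1 : PadicAlgCl p) - ((r₀ g).val 0 1 : PadicAlgCl p) * (Q.val 1 0 / Q.val 0 0) := by
    linear_combination htr - hB00
  -- the unit-root character is `≡ d`, and by hypothesis `≡ a`: contradiction with distinguishedness
  obtain ⟨t, ht, hta⟩ := hunit
  have htd : t = (r₀ g).val 1 1 - (r₀ g).val 0 1 * u := by
    apply Subtype.coe_injective
    push_cast
    rw [ht, hB11, hu_def]
  have htd' : t - (r₀ g).val 1 1 ∈ maximalIdeal O := by
    rw [htd, sub_sub_cancel_left]
    exact (maximalIdeal O).neg_mem (Ideal.mul_mem_left _ _ hum)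
  apply hdist
  have := Ideal.sub_mem _ htd' hta
  -- (t - d) - (t - a) = a - d
  convert this using 1; ring

/-- `oriented_of_unitRoot_congr` at a finite place, in the shape of the crux's local clause: an
ordinary frame for `r.toLocal v` whose unit-root entry is `≡ (r₀ σ₀)₀₀` at one residually
distinguished `σ₀ ∈ Γ_{F_v}` is oriented. [folklore] -/
theorem oriented_of_unitRoot_congr_toLocal {F : Type} [Field F] [NumberField F]
    (hO : O = (Valued.v : Valuation (PadicAlgCl p) NNReal).valuationSubring)
    {r : FramedGaloisRep F (PadicAlgCl p) 2}
    {r₀ : absoluteGaloisGroup F →* Matrix.GeneralLinearGroup (Fin 2) O}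
    (hmod : r.HasUpperTriangularIntegralModel r₀) (v : HeightOneSpectrum (𝓞 F))
    (Q : Matrix.GeneralLinearGroup (Fin 2) (PadicAlgCl p))
    (σ₀ : absoluteGaloisGroup (v.adicCompletion F))
    (hB : (Q⁻¹ * r.toLocal v σ₀ * Q).val 1 0 = 0)
    (hunit : ∃ t : O, (t : PadicAlgCl p) = (Q⁻¹ * r.toLocal v σ₀ * Q).val 1 1 ∧
      t - (r₀ (absGaloisRestrict F (v.adicCompletion F) σ₀)).val 0 0 ∈ maximalIdeal O)
    (hdist : (r₀ (absGaloisRestrict F (v.adicCompletion F) σ₀)).val 0 0 -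
      (r₀ (absGaloisRestrict F (v.adicCompletion F) σ₀)).val 1 1 ∉ maximalIdeal O) :
    Valued.v (Q.val 0 0) ≤ Valued.v (Q.val 1 0) :=
  oriented_of_unitRoot_congr hO hmod Q (absGaloisRestrict F (v.adicCompletion F) σ₀) hB hunit hdist

end Orientation

end Summit.Langlands.Langlands.Theorems.EisensteinProModularSeed.Negative
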